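import Mathlib
import Literature.Analysis.FluidPDE.Tao2016AveragedNS.ShiftSetCascadeFlows
import Literature.Analysis.FluidPDE.Tao2016AveragedNS.ShiftSetCascadeFlux
import Summits.NavierStokesRegularity.NavierStokesRegularity.Theorems.TaoLadderRungTwoFlatCertificateGlueCheckerStepGenOn
import Summits.NavierStokesRegularity.NavierStokesRegularity.Theorems.TaoLadderRungTwoFlatCertificateGlueCheckerBranchVectorOn
import Summits.NavierStokesRegularity.NavierStokesRegularity.Theorems.TaoLadderRungTwoFlatCertificateGlueCheckerTrapOn
import HarnessLib

/-!
# Certificate glue on a shift set `𝕊`, XXIX-d: THE BRANCH CHECKER OVER A GENERIC COEFFICIENT-BOX TABLE — glue XXIX-c with `coefBoxOf prec αq ωq Sp Sm` replaced by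
  any table `cB` (checked once by `checkGlobalG`, which includes the (B)-table test on `cB`; `CoefBoxOK` of `cB` is a hypothesis — for the lookup table of
  glue XXV-m it is `coefBoxOK_lookup` of the Boolean `checkCoefTab`) (helper for items stmt-NavierStokesRegularity-22987 `FlatGapCertificatesV2` (crux K_A♭ of
  route TaoLadderRungTwoFlat) and stmt-24295 K_A₂(64); cell harvest/h2-tao-ladder, p1 g16; PERFORMANCE refactor)

`checkGlobalG`, `checkStepG` (ONE Boolean per step), `stepCert_of_checkStepG`, `hullBound_of_checkTransitG`, `transitBranchG_of_checks`, `htrap_of_chainChecksG` — the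
mesh `tOfV`, `node0_of_boxV`, `checkNonneg` are those of glue XXIX-c.

HONEST FRAMING: Tao-type MODEL lattices (Tao 2016 §4/§6 vocabulary, shift-set parametrised); soundness of a checker — NO certificate instance exists
in the tree, nothing is certified here, no stub is closed, nothing here is a statement about the Navier–Stokes equations.
-/

-- the sub-problem namespace repeats the summit name by design (D-0017)
set_option linter.dupNamespace false

namespace Summit.NavierStokesRegularity.NavierStokesRegularity.Theorems

open Set Finset Literature.Analysis.FluidPDE Literature.Analysis.FluidPDE.TaoCascade
open Summit.NavierStokesRegularity.NavierStokesRegularity.Theorems.TaylorModelCert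
open Summit.NavierStokesRegularity.NavierStokesRegularity.Theorems.TaylorModelReadout

namespace CertificateGlueOn

variable {m : ℕ} {Kb Ka : ℤ}

/-! ### The transit test on the record's box -/

/-- **Hull states of a transit step stay in the open `M`-box** (glue XXIX `checkTransit` on the record's box; generic table). [folklore] -/
theorem hullBound_of_checkTransitG {shifts : List (ℤ × ℤ × ℤ)} (hnd : shifts.Nodup) {cB : Fin m → ℤ → Fin m → Fin m → ℤ × ℤ × ℤ → IntervalD}
    {ωq : Fin m → ℤ → ℚ} (hω : ∀ i k, 0 < ωq i k) {rec : ℕ → VRec} {j : ℕ} {Mq : ℤ → ℚ} (hAA' : (rec j).A ≤ (rec j).A')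
    (h13 : checkCoverV m Kb Ka shifts cB (rec j).x (rec j).ρ (rec j).E (rec j).lo (rec j).hi (rec j).h (rec j).A' = true)
    (htr : checkTransit m Kb Ka ωq Mq (rec j).lo (rec j).hi = true)
    {y : Fin m → ℤ → ℝ} (hy : hullOfG Kb Ka shifts cB ωq rec j y) :
    ∀ i k, -Kb ≤ k → k ≤ Ka → |y i k| < (Mq k : ℝ) := by
  intro i k hk1 hk2
  have hw : -Kb ≤ k ∧ k ≤ Ka := ⟨hk1, hk2⟩
  have hb := hull_coord_boundsG hnd hω hAA' h13 hy i hw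
  rw [idxOf_val i hw] at hb
  simp only [checkTransit, List.all_eq_true, List.mem_finRange, List.mem_range, Bool.and_eq_true, decide_eq_true_eq,
    true_implies] at htr
  have hcc : (k + Kb).toNat < winLen Kb Ka := by
    unfold winLen; rw [Int.toNat_lt_toNat (by omega)]; omega
  obtain ⟨h1, h2⟩ := htr i (k + Kb).toNat hcc
  rw [Int.toNat_of_nonneg (by omega), show k + Kb - Kb = k by ring] at h1 h2
  have h1r := (Rat.cast_lt (K := ℝ)).mpr h1
  have h2r := (Rat.cast_lt (K := ℝ)).mpr h2
  simp only [Rat.cast_mul, Rat.cast_neg, cast_dyadToRat] at h1r h2r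
  rw [abs_lt]
  exact ⟨by linarith [hb.1], by linarith [hb.2]⟩

/-! ### One Boolean test per step -/

/-- **The once-per-certificate tests over a given coefficient table**: square-root enclosures of `(1+q)^{±1/2}`, `-1 < q`, `0 ≤ b`, and the (B)-table (C1) of `cB`.
[folklore] -/
def checkGlobalG (m : ℕ) (Kb Ka : ℤ) (prec : ℕ) (shifts : List (ℤ × ℤ × ℤ)) (cB : Fin m → ℤ → Fin m → Fin m → ℤ × ℤ × ℤ → IntervalD)
    (q : ℚ) (Sp Sm : IntervalD) (bD : Dyad) : Bool :=
  sqrtCheck prec (1 + q) Sp && sqrtCheck prec (1 / (1 + q)) Sm && decide (-1 < q) && Dyad.ble (Dyad.ofInt 0) bD && checkB m Kb Ka shifts cB bD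


/-- **ALL TESTS OF VECTOR-LAYOUT STEP `j` OVER THE TABLE `cB`** (signs, hand-over, C2, C3v, hull radii, C6v, C8vr, C9v, cover C13v, K-table, defect table, Grönwall) as
one Boolean. [folklore] -/
def checkStepG (m : ℕ) (Kb Ka : ℤ) (prec p kexp nexp : ℕ) (shifts : List (ℤ × ℤ × ℤ))
    (cB : Fin m → ℤ → Fin m → Fin m → ℤ × ℤ × ℤ → IntervalD)
    (αq : Fin m → Fin m → Fin m → ℤ × ℤ × ℤ → ℚ) (ωq : Fin m → ℤ → ℚ) (Sp Sm : IntervalD) (bD : Dyad) (Eb Et : ℚ)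
    (rec : ℕ → VRec) (j : ℕ) : Bool :=
  let n := m * winLen Kb Ka
  let s := rec j
  let hI := ofRatRel prec s.h
  let JX := IntervalD.jetLevelsA n (pqBoxA Kb Ka prec shifts cB) prec (pointBoxA n s.x) p
  let JH := IntervalD.jetLevelsA n (pqBoxA Kb Ka prec shifts cB) prec (hullBoxA n s.x s.ρ s.E) p
  Dyad.ble (Dyad.ofInt 0) s.mC && Dyad.ble (Dyad.ofInt 0) s.ρs && decide (s.A < s.A') && decide (0 < s.h) &&
  checkHandsOverV n s (rec (j + 1)) &&
  checkAbsLe n s.x s.mC && checkRowsLe n s.C s.r s.ρ && checkHull n s.ρ s.E s.ρs && checkRowsLe n s.T s.r s.r' &&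
  checkERecVR m Kb Ka shifts cB p (dyadToRat bD) (dyadToRat s.mC) (dyadToRat s.ρs) s.h
    (dPArr n prec (IntervalD.polyLevelsA n prec JX p hI) s.x')
    (kappaArr prec n s.Cn s.T (vcolsA Kb Ka prec shifts cB p JH hI s.C) s.r)
    (nveArr n (IntervalD.polyLevelsA n prec (IntervalD.varJetLevelsA n (pqBoxA Kb Ka prec shifts cB) prec JH (symBoxA n s.E) p) p hI))
    s.E1 &&
  checkGuardV (dyadToRat bD) (dyadToRat s.mC) (dyadToRat s.ρs) s.h &&
  checkCoverV m Kb Ka shifts cB s.x s.ρ s.E s.lo s.hi s.h s.A' &&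
  checkLipT m Kb Ka shifts cB s.lo s.hi s.K &&
  checkDefectT m Kb Ka prec shifts αq ωq Eb Et s.lo s.hi Sp Sm s.δ &&
  checkGronwallK s.K (dyadToRat s.δ) s.h s.A kexp nexp

/-- **`StepCert` OF STEP `j` FROM THE TWO BOOLEANS** `checkGlobalG` and `checkStepG … j` (plus `CoefBoxOK` of the table), on the mesh `tOfV rec`.
[cite: Zgliczynski2002C1Lohner, §3–4 (Lohner-type parallelepiped frames and the C¹/variational enclosure); cell certificate format, branch checker, vector remainder] -/
theorem stepCert_of_checkStepG (hKb : 0 ≤ Kb) (hKa : 1 ≤ Ka) {shifts : List (ℤ × ℤ × ℤ)} (hnd : shifts.Nodup)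
    (h𝕊 : IsNearestNeighbourSet shifts.toFinset) {q : ℚ} {cB : Fin m → ℤ → Fin m → Fin m → ℤ × ℤ × ℤ → IntervalD}
    {αq : Fin m → Fin m → Fin m → ℤ × ℤ × ℤ → ℚ} {ωq : Fin m → ℤ → ℚ} (hω : ∀ i k, 0 < ωq i k)
    (hcoef : CoefBoxOK shifts (q : ℝ) (fun i₁ i₂ i μ => (αq i₁ i₂ i μ : ℝ)) Kb Ka (fun i k => (ωq i k : ℝ)) cB)
    {prec p kexp nexp : ℕ} {Sp Sm : IntervalD} {bD : Dyad} {Eb Et : ℚ} {M : ℤ → ℝ} {rec : ℕ → VRec} {j : ℕ}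
    (hg : checkGlobalG m Kb Ka prec shifts cB q Sp Sm bD = true)
    (hs : checkStepG m Kb Ka prec p kexp nexp shifts cB αq ωq Sp Sm bD Eb Et rec j = true) :
    StepCert shifts.toFinset (q : ℝ) (fun i₁ i₂ i μ => (αq i₁ i₂ i μ : ℝ)) Kb Ka (Eb : ℝ) (Et : ℝ) M (tOfV rec)
      (nodeOfV Kb Ka ωq rec) (hullOfG Kb Ka shifts cB ωq rec) j := by
  simp only [checkGlobalG, Bool.and_eq_true, decide_eq_true_eq, Dyad.ble_iff, Dyad.toReal_ofInt, Int.cast_zero] at hg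
  obtain ⟨⟨⟨⟨hSp, hSm⟩, hq⟩, hb⟩, hchkB⟩ := hg
  simp only [checkStepG, Bool.and_eq_true, decide_eq_true_eq, Dyad.ble_iff, Dyad.toReal_ofInt, Int.cast_zero] at hs
  obtain ⟨⟨⟨⟨⟨⟨⟨⟨⟨⟨⟨⟨⟨⟨hmC, hρs⟩, hAA'⟩, hh⟩, hho⟩, h2⟩, h3⟩, hhull⟩, h6⟩, h8⟩, h9⟩, h13⟩, h10⟩, h11⟩, h12⟩ := hs
  have hq' : 0 < 1 + (q : ℝ) := by
    have : ((-1 : ℚ) : ℝ) < (q : ℝ) := by exact_mod_cast hq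
    push_cast at this; linarith
  exact stepCert_of_recG hKb hKa hnd h𝕊 hq' hω hSp hSm hcoef hb hmC hρs hAA' (tOfV_succ_sub rec j) hho hchkB h2 h3 hhull h6 h8 h9 h13 h10
    h11 h12

/-- **THE PER-BRANCH PACKAGE FOR A TRANSIT BRANCH (GENERIC TABLE)**: tests of steps `0 … N−1` and their transit tests ⇒ the mesh facts `ht0`, `hmono`,
the step certificates `hstep` and the hull bound `hhull` of glue XXII `htrap_of_branchMeshes` for this branch. [folklore] -/
theorem transitBranchG_of_checks (hKb : 0 ≤ Kb) (hKa : 1 ≤ Ka) {shifts : List (ℤ × ℤ × ℤ)} (hnd : shifts.Nodup)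
    (h𝕊 : IsNearestNeighbourSet shifts.toFinset) {q : ℚ} {cB : Fin m → ℤ → Fin m → Fin m → ℤ × ℤ × ℤ → IntervalD}
    {αq : Fin m → Fin m → Fin m → ℤ × ℤ × ℤ → ℚ} {ωq : Fin m → ℤ → ℚ} (hω : ∀ i k, 0 < ωq i k)
    (hcoef : CoefBoxOK shifts (q : ℝ) (fun i₁ i₂ i μ => (αq i₁ i₂ i μ : ℝ)) Kb Ka (fun i k => (ωq i k : ℝ)) cB)
    {prec p kexp nexp : ℕ} {Sp Sm : IntervalD} {bD : Dyad} {Eb Et : ℚ} {Mq : ℤ → ℚ} {rec : ℕ → VRec} {N : ℕ}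
    (hg : checkGlobalG m Kb Ka prec shifts cB q Sp Sm bD = true)
    (hs : ∀ j, j < N → checkStepG m Kb Ka prec p kexp nexp shifts cB αq ωq Sp Sm bD Eb Et rec j = true)
    (htr : ∀ j, j < N → checkTransit m Kb Ka ωq Mq (rec j).lo (rec j).hi = true) :
    tOfV rec 0 = 0 ∧ (∀ j, j < N → tOfV rec j < tOfV rec (j + 1)) ∧
    (∀ j, j < N → StepCert shifts.toFinset (q : ℝ) (fun i₁ i₂ i μ => (αq i₁ i₂ i μ : ℝ)) Kb Ka (Eb : ℝ) (Et : ℝ)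
      (fun k => (Mq k : ℝ)) (tOfV rec) (nodeOfV Kb Ka ωq rec) (hullOfG Kb Ka shifts cB ωq rec) j) ∧
    (∀ j, j < N → ∀ y, hullOfG Kb Ka shifts cB ωq rec j y → ∀ i k, -Kb ≤ k → k ≤ Ka → |y i k| < (Mq k : ℝ)) := by
  refine ⟨tOfV_zero rec, fun j hj => ?_, fun j hj => stepCert_of_checkStepG hKb hKa hnd h𝕊 hω hcoef hg (hs j hj), fun j hj y hy => ?_⟩
  · have h := hs j hj
    simp only [checkStepG, Bool.and_eq_true, decide_eq_true_eq] at h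
    exact tOfV_lt_succ h.1.1.1.1.1.1.1.1.1.1.1.2
  · have h := hs j hj
    simp only [checkStepG, Bool.and_eq_true, decide_eq_true_eq] at h
    have hAA' : (rec j).A ≤ (rec j).A' := le_of_lt h.1.1.1.1.1.1.1.1.1.1.1.1.2
    exact hullBound_of_checkTransitG hnd hω hAA' h.1.1.1.2 (htr j hj) hy

/-! ### The trapping clause from checked transit branch chains -/

variable {ι : Type*} {Core : (Fin m → ℤ → ℝ) → Prop} {w : ℤ → ℝ} {r : ℝ}

/-- **THE TRAPPING CLAUSE `htrap` FROM CHECKED TRANSIT BRANCH CHAINS (GENERIC TABLE).** Per branch `b`: records `rec b`, `N b` steps with `checkStepG`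
and `checkTransit` passing, the clock `c ≤ Σ_{j<N b} h`, the start frame the identity with a nonnegative remainder vector; globally `checkGlobal`; and
the fattened core covered by the weighted start boxes ⇒ `htrap` (open `M`-box `M k = Mq k`, clock `c`, edge bounds `Eb`, `Et`).
[cite: Tao2016AveragedNS, §6.3–6.4 Props. 6.4–6.5 (statement shape of a renormalisation certificate); cell certificate format, branch checker, vector remainder] -/
theorem htrap_of_chainChecksG (hKb : 0 ≤ Kb) (hKa : 1 ≤ Ka) {shifts : List (ℤ × ℤ × ℤ)} (hnd : shifts.Nodup)
    (h𝕊 : IsNearestNeighbourSet shifts.toFinset) {q : ℚ} {cB : Fin m → ℤ → Fin m → Fin m → ℤ × ℤ × ℤ → IntervalD}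
    {αq : Fin m → Fin m → Fin m → ℤ × ℤ × ℤ → ℚ} {ωq : Fin m → ℤ → ℚ} (hω : ∀ i k, 0 < ωq i k)
    (hcoef : CoefBoxOK shifts (q : ℝ) (fun i₁ i₂ i μ => (αq i₁ i₂ i μ : ℝ)) Kb Ka (fun i k => (ωq i k : ℝ)) cB)
    {prec p kexp nexp : ℕ} {Sp Sm : IntervalD} {bD : Dyad} {Eb Et c : ℚ} {Mq : ℤ → ℚ}
    {rec : ι → ℕ → VRec} {N : ι → ℕ}
    (hg : checkGlobalG m Kb Ka prec shifts cB q Sp Sm bD = true)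
    (hs : ∀ b j, j < N b → checkStepG m Kb Ka prec p kexp nexp shifts cB αq ωq Sp Sm bD Eb Et (rec b) j = true)
    (htr : ∀ b j, j < N b → checkTransit m Kb Ka ωq Mq (rec b j).lo (rec b j).hi = true)
    (hc : ∀ b, c ≤ sumHV (rec b) (N b))
    (hid : ∀ b, checkIdFrame (m * winLen Kb Ka) (rec b 0).C = true) (hE : ∀ b, checkNonneg (m * winLen Kb Ka) (rec b 0).E = true)
    (hcover : ∀ (z S₀ : Fin m → ℤ → ℝ), Core z → (∀ i k, -Kb ≤ k → k ≤ Ka → w k * |S₀ i k - z i k| ≤ r) →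
      ∃ b, ∀ d, |pxcoord Kb Ka (fun i k => (ωq i k : ℝ)) S₀ d - dvec (n := m * winLen Kb Ka) (rec b 0).x d| ≤
        dvec (n := m * winLen Kb Ka) (rec b 0).r d) :
    ∀ (s : ℝ) (z : Fin m → ℤ → ℝ) (S : Fin m → ℤ → ℝ → ℝ), Core z → 0 < s → s ≤ (c : ℝ) →
      (∀ i k, -Kb ≤ k → k ≤ Ka → w k * |S i k 0 - z i k| ≤ r) →
      (∀ i k, -Kb ≤ k → k ≤ Ka → ∀ u ∈ Icc 0 s,
        HasDerivWithinAt (S i k) (quadTermOn shifts.toFinset (q : ℝ) (fun i₁ i₂ i μ => (αq i₁ i₂ i μ : ℝ)) S i k u) (Icc 0 s) u) →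
      (∀ i, ContinuousOn (S i (-Kb - 1)) (Icc 0 s)) → (∀ i, ContinuousOn (S i (Ka + 1)) (Icc 0 s)) →
      (∀ i, ∀ u ∈ Icc 0 s, |S i (-Kb - 1) u| ≤ (Eb : ℝ)) →
      (∀ i, ∀ u ∈ Icc 0 s, |S i (Ka + 1) u| ≤ (Et : ℝ)) →
      (∀ i k, -Kb ≤ k → k ≤ Ka → ∀ u ∈ Icc 0 s, |S i k u| ≤ (Mq k : ℝ)) →
        ∀ i k, -Kb ≤ k → k ≤ Ka → ∀ u ∈ Icc 0 s, |S i k u| < (Mq k : ℝ) := by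
  have hbr := fun b => transitBranchG_of_checks hKb hKa hnd h𝕊 hω hcoef hg (hs b) (htr b)
  exact htrap_of_branchMeshes
    (Box := fun b S₀ => ∀ d, |pxcoord Kb Ka (fun i k => (ωq i k : ℝ)) S₀ d - dvec (n := m * winLen Kb Ka) (rec b 0).x d| ≤
      dvec (n := m * winLen Kb Ka) (rec b 0).r d)
    (t := fun b => tOfV (rec b)) (Node := fun b => nodeOfV Kb Ka ωq (rec b))
    (Hull := fun b => hullOfG Kb Ka shifts cB ωq (rec b))
    hcover (fun b => (hbr b).1) (fun b => (hbr b).2.1) (fun b => le_tOfV_of_le_sumHV (hc b))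
    (fun b y hy => node0_of_boxV (hid b) (hE b) hy) (fun b => (hbr b).2.2.1) (fun b => (hbr b).2.2.2)

end CertificateGlueOn

end Summit.NavierStokesRegularity.NavierStokesRegularity.Theorems
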